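import Summits.ResolutionOfSingularities.ResolutionOfSingularities.Theorems.FrobeniusClosingSteerEtaleWindowWords
import Mathlib.RingTheory.Algebraic.Integral
import Mathlib.FieldTheory.Perfect
import HarnessLib

/-!
# [OURS · L0 W4.1] One level of the étale lift: TRANSPORT of window data along level maps and the ALGEBRAIC (hence, over a perfect residue field,
# SEPARABLE) residue extension of a `LevelLift` level (kit for the W-NRA-B route; res-L0-w41-plan-1 RULING 316 (c); `--supports … --as helper`)

HONEST FRAMING. OURS kernel (HIRONAKA-L librarian res-D-lib-1 gen 8). Generic lemmas about ONE level `φ : S → S′` of the étale window/chain lift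
(`EtaleLift.LevelLift S S′ φ θ`, `…EtaleWindowWords`) and about a pair of levels commuting with an inclusion `A ≤ B`:
* `mul_lift`, `law3_lift` — transport of the product identities `a = b·c` and of the F3-type law `f₁·xⁿ·W² = f₀ − G²` read in the ambient fields;
* `span_insert_range_lift`, `mem_pow_lift` — transport of `𝔪 = (x, u)` presentations and of `a ∈ 𝔪ⁿ` along an UNRAMIFIED map;
* `isIntegral_residue_of_isIntegral` — residues of integral elements are integral (Mathlib's residue-field algebra of a local map);
* **`isAlgebraic_residueField_of_levelLift`** — the residue extension of a level is ALGEBRAIC (generation by `φ(S)` and the integral `θ`), and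
  **`isSeparable_residueField_of_levelLift`** — hence SEPARABLE when `κ(S)` is perfect.
(The window-level use for W-NRA-B needs the adapted windows produced UPSTAIRS; see res-D-lib-1's STATUS CORRECTION 2026-08-27T22:07:43Z — a lift that
ASSUMES downstairs adapted windows is vacuous at a non-rational window, so none is stated here.)
Nothing here is a statement of H. Hironaka's manuscript [Hironaka2017]. AI-written; AI review is weaker than expert review. [folklore]
-/

set_option linter.dupNamespace false

noncomputable section

namespace Summit.ResolutionOfSingularities.ResolutionOfSingularities.Theorems.SwitchingDichotomy.EtaleLift

open IsLocalRing Polynomial Literature.AlgebraicGeometry.Resolution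

/-! ## §1 Transport of window data along level maps -/

section Transfer

variable {L L' : Type} [Field L] [Field L'] {A B : Subring L} {A' B' : Subring L'} (hle : A ≤ B)
  (φA : A →+* A') (φB : B →+* B') (hcomm : ∀ s : A, ((φB (Subring.inclusion hle s) : B') : L') = ((φA s : A') : L'))

include hcomm

/-- Transport of a product `a = b · c` (`a, b ∈ A`, `c ∈ B`, read in `L`). [folklore] -/
theorem mul_lift (a b : A) (c : B) (h : ((a : A) : L) = ((b : A) : L) * ((c : B) : L)) :
    ((φA a : A') : L') = ((φA b : A') : L') * ((φB c : B') : L') := by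
  have h1 : Subring.inclusion hle a = Subring.inclusion hle b * c := by
    apply Subtype.ext
    simp only [Subring.coe_mul, Subring.coe_inclusion]
    exact h
  have h2 := congrArg (fun z : B' => (z : L')) (congrArg φB h1)
  simp only [map_mul, Subring.coe_mul, hcomm] at h2
  exact h2

/-- Transport of the F3 law `f₁ · xⁿ · W² = f₀ − G²` (`x, f₀ ∈ A`; `f₁, W, G ∈ B`). [folklore] -/
theorem law3_lift (x f₀ : A) (f₁ W G : B) (n : ℕ)
    (h : ((f₁ : B) : L) * ((x : A) : L) ^ n * ((W : B) : L) ^ 2 = ((f₀ : A) : L) - ((G : B) : L) ^ 2) :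
    ((φB f₁ : B') : L') * ((φA x : A') : L') ^ n * ((φB W : B') : L') ^ 2 = ((φA f₀ : A') : L') - ((φB G : B') : L') ^ 2 := by
  have h1 : f₁ * (Subring.inclusion hle x) ^ n * W ^ 2 = Subring.inclusion hle f₀ - G ^ 2 := by
    apply Subtype.ext
    simp only [Subring.coe_mul, SubmonoidClass.coe_pow, AddSubgroupClass.coe_sub, Subring.coe_inclusion]
    exact h
  have h2 := congrArg (fun z : B' => (z : L')) (congrArg φB h1)
  simp only [map_mul, map_pow, map_sub, Subring.coe_mul, SubmonoidClass.coe_pow, AddSubgroupClass.coe_sub, hcomm] at h2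
  exact h2

end Transfer

/-- Transport of a presentation of the maximal ideal `𝔪 = (x, u)` along an unramified map. [folklore] -/
theorem span_insert_range_lift {S S' : Type} [CommRing S] [CommRing S'] [IsLocalRing S] [IsLocalRing S'] (φ : S →+* S')
    (hunr : (maximalIdeal S).map φ = maximalIdeal S') (x : S) {n : ℕ} (u : Fin n → S)
    (h : Ideal.span (insert x (Set.range u)) = maximalIdeal S) :
    Ideal.span (insert (φ x) (Set.range fun i => φ (u i))) = maximalIdeal S' := by
  rw [← hunr, ← h, Ideal.map_span, Set.image_insert_eq, ← Set.range_comp]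
  rfl

/-- Transport of a membership `a ∈ 𝔪^n` along an unramified map. [folklore] -/
theorem mem_pow_lift {S S' : Type} [CommRing S] [CommRing S'] [IsLocalRing S] [IsLocalRing S'] (φ : S →+* S')
    (hunr : (maximalIdeal S).map φ = maximalIdeal S') {n : ℕ} {a : S} (h : a ∈ maximalIdeal S ^ n) : φ a ∈ maximalIdeal S' ^ n := by
  have h' := Ideal.mem_map_of_mem φ h
  rwa [Ideal.map_pow, hunr] at h'

/-! ## §2 The residue extension of one level of the lift is algebraic -/

/-- The residue of an integral element is integral over the residue field (read through Mathlib's residue-field algebra of a local map).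
[folklore] -/
theorem isIntegral_residue_of_isIntegral {S S' : Type} [CommRing S] [CommRing S'] [IsLocalRing S] [IsLocalRing S'] [Algebra S S']
    [IsLocalHom (algebraMap S S')] {a : S'} (ha : IsIntegral S a) : IsIntegral (ResidueField S) (residue S' a) := by
  obtain ⟨q, hqm, hq⟩ := ha
  refine ⟨q.map (residue S), hqm.map _, ?_⟩
  have hcomp : (algebraMap (ResidueField S) (ResidueField S')).comp (residue S) = (residue S').comp (algebraMap S S') := by
    ext s
    exact IsLocalRing.ResidueField.algebraMap_residue s
  rw [Polynomial.eval₂_map, hcomp, ← Polynomial.hom_eval₂, hq, map_zero]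

/-- **The residue extension of a level `φ : S → S′` of the lift is ALGEBRAIC** (read through Mathlib's residue-field algebra of the local map `φ`):
`S′` is generated by `φ(S)` and `θ` up to units of `S′`, and `θ` is integral (a root of the monic `P` through `φ`). [folklore] -/
theorem isAlgebraic_residueField_of_levelLift {L L' : Type} [Field L] [Field L'] {S : Subring L} {S' : Subring L'}
    [IsLocalRing S] [IsLocalRing S'] {φ : S →+* S'} {θ : L'} (h : LevelLift S S' φ θ)
    (P : S[X]) (hP : P.Monic) (hPθ : P.eval₂ (S'.subtype.comp φ) θ = 0) :
    haveI : IsLocalHom φ := h.1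
    letI := φ.toAlgebra
    haveI : IsLocalHom (algebraMap S S') := h.1
    Algebra.IsAlgebraic (ResidueField S) (ResidueField S') := by
  haveI : IsLocalHom φ := h.1
  letI := φ.toAlgebra
  haveI : IsLocalHom (algebraMap S S') := h.1
  obtain ⟨-, -, -, hθ, hgen, -⟩ := h
  -- `θ` and `φ(S)` are integral over `S`, hence so is the subring `B′` of `S′` they generate
  have hθint : IsIntegral S (⟨θ, hθ⟩ : S') := by
    refine ⟨P, hP, ?_⟩
    have : (S'.subtype) (Polynomial.eval₂ (algebraMap S S') ⟨θ, hθ⟩ P) = 0 := by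
      rw [Polynomial.hom_eval₂]
      exact hPθ
    exact (map_eq_zero_iff _ Subtype.val_injective).mp this
  let B' : Subring S' := Subring.closure (Set.range (algebraMap S S') ∪ {⟨θ, hθ⟩})
  have hB'int : ∀ b ∈ B', IsIntegral S b := by
    intro b hb
    have hle : B' ≤ (integralClosure S S').toSubring := by
      refine Subring.closure_le.mpr ?_
      rintro w (⟨s, rfl⟩ | hw)
      · exact isIntegral_algebraMap
      · rw [Set.mem_singleton_iff] at hw
        subst hw
        exact hθint
    exact hle hb
  -- the closure in `L′` is the image of `B′`
  have hB : Subring.closure (Set.range (fun s : S => ((φ s : S') : L')) ∪ {θ}) = B'.map S'.subtype := by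
    rw [RingHom.map_closure, Set.image_union, Set.image_singleton, ← Set.range_comp]
    rfl
  refine ⟨fun z => ?_⟩
  obtain ⟨z, rfl⟩ := residue_surjective z
  obtain ⟨u, hu, v, hv, hvinv, hz⟩ := hgen (z : L') z.2
  rw [hB] at hu hv
  obtain ⟨u', hu', rfl⟩ := hu
  obtain ⟨v', hv', rfl⟩ := hv
  -- `z = u′ * w` with `w := v⁻¹ ∈ S′`
  have hzS : z = u' * ⟨((v' : S') : L')⁻¹, hvinv⟩ := by
    apply Subtype.ext
    change (z : L') = (u' : L') * ((v' : S') : L')⁻¹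
    rw [hz, div_eq_mul_inv]
    rfl
  rw [hzS, map_mul]
  have hu'alg : IsIntegral (ResidueField S) (residue S' u') := isIntegral_residue_of_isIntegral (hB'int u' hu')
  have hv'alg : IsIntegral (ResidueField S) (residue S' v') := isIntegral_residue_of_isIntegral (hB'int v' hv')
  -- the residue of `w` is the inverse of the residue of `v′` (or `0`)
  by_cases hv0 : ((v' : S') : L') = 0
  · have : (⟨((v' : S') : L')⁻¹, hvinv⟩ : S') = 0 := Subtype.ext (by change ((v' : S') : L')⁻¹ = 0; rw [hv0, inv_zero])
    rw [this, map_zero, mul_zero]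
    exact isAlgebraic_zero
  · have hw : residue S' (⟨((v' : S') : L')⁻¹, hvinv⟩ : S') = (residue S' v')⁻¹ := by
      have hmul : v' * (⟨((v' : S') : L')⁻¹, hvinv⟩ : S') = 1 :=
        Subtype.ext (by change ((v' : S') : L') * ((v' : S') : L')⁻¹ = 1; exact mul_inv_cancel₀ hv0)
      have h1 : residue S' v' * residue S' (⟨((v' : S') : L')⁻¹, hvinv⟩ : S') = 1 := by rw [← map_mul, hmul, map_one]
      exact (eq_inv_of_mul_eq_one_right h1)
    rw [hw]
    exact (hu'alg.isAlgebraic.mul (hv'alg.isAlgebraic.inv))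


/-- **… hence SEPARABLE over a perfect residue field.** [folklore] -/
theorem isSeparable_residueField_of_levelLift {L L' : Type} [Field L] [Field L'] {S : Subring L} {S' : Subring L'}
    [IsLocalRing S] [IsLocalRing S'] {φ : S →+* S'} {θ : L'} (h : LevelLift S S' φ θ)
    (P : S[X]) (hP : P.Monic) (hPθ : P.eval₂ (S'.subtype.comp φ) θ = 0) [PerfectField (ResidueField S)] :
    haveI : IsLocalHom φ := h.1
    letI := φ.toAlgebra
    haveI : IsLocalHom (algebraMap S S') := h.1
    Algebra.IsSeparable (ResidueField S) (ResidueField S') := by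
  haveI : IsLocalHom φ := h.1
  letI := φ.toAlgebra
  haveI : IsLocalHom (algebraMap S S') := h.1
  haveI := isAlgebraic_residueField_of_levelLift h P hP hPθ
  exact Algebra.IsAlgebraic.isSeparable_of_perfectField

end Summit.ResolutionOfSingularities.ResolutionOfSingularities.Theorems.SwitchingDichotomy.EtaleLift

end
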